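import Literature.Topology.FourManifolds.TautFoliationsConeStarData
import Literature.Topology.FourManifolds.TautFoliationsDiscFoliation
import Literature.Topology.PlanarFoliations.GenericSeparatrices
import Literature.Topology.PlanarFoliations.EssentialLeafVanishing
import HarnessLib

/-!
# An essential compact contour leaf of a disc in cone position yields a vanishing cycle

Topic: the junction of the planar part of Novikov's theorem
(`Literature/Topology/PlanarFoliations/EssentialLeafVanishing.lean`) with the disc in
checkerboard cone position (`TautFoliationsConeStarData.lean`): **if the contour foliation of a
disc in cone position has a compact leaf with essential image, and distinct vertex punctures inside that disc have images in distinct leaves of `F` (general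
position), then `F` has a vanishing cycle** (`ConePosition.exists_vanishingCycle_of_essential_leaf`,
**proved**: the star data of the cone position, the genericity hypothesis from
`GenericSeparatrices.hgen_of_leaf_injOn`, and the planar theorem).

What remains for Novikov's existence of vanishing cycles
(`Foliation.exists_vanishingCycle_of_not_injective`) is to produce such a disc from a
non-`π₁`-injective compact leaf: the coned fence collar (`TautFoliationsCollarLeaf.lean`) in the
closed-holonomy case, arranged in general position inside the disc of its essential ring leaf.

## References

* C. Camacho, A. Lins Neto, *Geometric Theory of Foliations*, Birkhäuser (1985), Ch. VII §2
  [CamachoLinsNeto1985].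
-/

noncomputable section

open Set Filter Metric Topology Function
open Literature.Topology.PlanarFoliations

namespace Literature.Topology.FourManifolds

namespace Foliation.ConePosition

open ConeSquare SquareGrid

variable {B : Type*} [NormedAddCommGroup B] [NormedSpace ℝ B] {M : Type*} [TopologicalSpace M]
  {F : Foliation B M} {f : ℝ × ℝ → M} {c₀ : ℝ × ℝ} {L : ℝ} {hL : 0 < L} (P : ConePosition F f c₀ hL)
  (ho : F.IsTransverselyOriented)

/-- **The disc of a compact contour leaf lies in the grid region**: a point outside the open
square is joined to infinity by a ray outside the square, off the leaf, hence is an outer point.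
[folklore] -/
theorem discLeaf_subset_Ω {y₀ : P.gr.X₀} (hK : IsCompact ((P.contourFol ho).leaf y₀)) :
    discLeaf (P.contourFol ho) P.gr.planeEmb y₀ ⊆ P.Ω := by
  have hbi : IsBiOriented (P.contourFol ho) := P.isBiOriented_contourFol ho
  have hι : IsOpenEmbedding P.gr.planeEmb := SquareGrid.Grid.isOpenEmbedding_planeEmb P.gr
  set Fc := P.contourFol ho with hFc
  set K := P.gr.planeEmb '' Fc.leaf y₀ with hKdef
  -- the image of the leaf lies in the open square
  have hKΩ : K ⊆ P.Ω := by
    rintro _ ⟨y, -, rfl⟩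
    rw [mem_Ω_iff, toR_planeEmb]
    exact ((P.gr.mem_X₀_iff).1 y.2).1
  intro z hz
  by_contra hzΩ
  -- the ray from `z` away from the centre
  set c : ℂ := ⟨P.gr.bigCentre.1, P.gr.bigCentre.2⟩ with hc
  set ray : ℝ → ℂ := fun t ↦ z + (t : ℂ) * (z - c) with hray
  have hrayc : Continuous ray := by fun_prop
  have htoR : ∀ t, toR (ray t) - P.gr.bigCentre = (1 + t) • (toR z - P.gr.bigCentre) := by
    intro t
    apply Prod.ext
    · simp only [hray, toR, hc, Complex.add_re, Complex.mul_re, Complex.ofReal_re, Complex.sub_re, Complex.ofReal_im,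
        Complex.sub_im, zero_mul, sub_zero, Prod.fst_sub, Prod.smul_fst, smul_eq_mul]
      ring
    · simp only [hray, toR, hc, Complex.add_im, Complex.mul_im, Complex.ofReal_re, Complex.sub_im, Complex.ofReal_im,
        Complex.sub_re, zero_mul, add_zero, Prod.snd_sub, Prod.smul_snd, smul_eq_mul]
      ring
  have hzd : P.gr.n * P.gr.ℓ ≤ dist (toR z) P.gr.bigCentre := by
    by_contra h; exact hzΩ ((mem_Ω_iff _).2 (mem_ball.2 (not_le.1 h)))
  have hoff : ∀ t, 0 ≤ t → ray t ∉ P.Ω := by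
    intro t ht hmem
    rw [mem_Ω_iff, mem_ball, dist_eq_norm, htoR, norm_smul, Real.norm_of_nonneg (by linarith)] at hmem
    rw [dist_eq_norm] at hzd
    nlinarith [norm_nonneg (toR z - P.gr.bigCentre)]
  have hoffK : ∀ t, 0 ≤ t → ray t ∉ K := fun t ht h ↦ hoff t ht (hKΩ h)
  -- `z` is off the leaf
  have hzK : z ∉ K := fun h ↦ hzΩ (hKΩ h)
  -- a far point of the ray is outer
  obtain ⟨-, -, -, -, -, -, hUb, -⟩ := insideLeaf_spec (ι := P.gr.planeEmb) hbi hι hK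
  obtain ⟨C, hC⟩ := hUb.subset_closedBall 0
  have hzc : z ≠ c := by
    intro h
    apply hzΩ
    rw [mem_Ω_iff, h]
    have : toR c = P.gr.bigCentre := rfl
    rw [this]; exact mem_ball_self (by have := P.gr.hℓ; have := P.hn; positivity)
  have hnorm : 0 < ‖z - c‖ := norm_pos_iff.2 (sub_ne_zero.2 hzc)
  set t₁ : ℝ := (C + ‖z‖ + 1) / ‖z - c‖ with ht₁
  have ht₁0 : 0 ≤ t₁ := by
    have : 0 ≤ C := by
      by_contra hC0
      have hne := (insideLeaf_spec (ι := P.gr.planeEmb) hbi hι hK).2.2.1.nonempty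
      obtain ⟨w, hw⟩ := hne
      have := hC hw; rw [mem_closedBall, dist_zero_right] at this; linarith [norm_nonneg w]
    positivity
  have hfar : ray t₁ ∉ insideLeaf Fc P.gr.planeEmb y₀ := fun h ↦ by
    have h1 := hC h
    rw [mem_closedBall, dist_zero_right] at h1
    have h2 : t₁ * ‖z - c‖ ≤ ‖ray t₁‖ + ‖z‖ := by
      have h3 := norm_sub_le (ray t₁) z
      have h4 : ray t₁ - z = (t₁ : ℂ) * (z - c) := by simp only [hray]; ring
      rw [h4, norm_mul, Complex.norm_real, Real.norm_of_nonneg ht₁0] at h3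
      exact h3
    have h4 : t₁ * ‖z - c‖ = C + ‖z‖ + 1 := by rw [ht₁]; field_simp
    linarith
  have hfarout : ray t₁ ∈ outsideLeaf Fc P.gr.planeEmb y₀ := by
    rcases mem_insideLeaf_or_mem_outsideLeaf (hoffK t₁ ht₁0) with h | h
    · exact absurd h hfar
    · exact h
  -- the ray is connected and off the leaf: `z = ray 0` is outer
  have hRc : IsPreconnected (ray '' Ici 0) := isPreconnected_Ici.image _ hrayc.continuousOn
  have hRK : Disjoint (ray '' Ici 0) K := disjoint_left.2 (by rintro _ ⟨t, ht, rfl⟩ h; exact hoffK t ht h)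
  have hsub := subset_outsideLeaf_of_isPreconnected hbi hι hK hRc hRK ⟨_, ⟨t₁, ht₁0, rfl⟩, hfarout⟩
  have hz0 : z = ray 0 := by simp [hray]
  have hzout : z ∈ outsideLeaf Fc P.gr.planeEmb y₀ := hsub ⟨0, Set.self_mem_Ici, hz0.symm⟩
  rcases hz with h | h
  · exact hzK h
  · exact disjoint_left.1 (disjoint_insideLeaf_outsideLeaf y₀) h hzout

/-- The foliated map of the star data is that of the filled map: image-null leaves agree.
[folklore] -/
theorem imageNull_starData_iff (y : P.gr.X₀) : ImageNull (P.starData ho).foliated y ↔ ImageNull (P.isFoliatedMap_fill ho) y := Iff.rfl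

/-- **An essential compact contour leaf of a disc in cone position, in general position inside
its disc, yields a vanishing cycle of `F`.** [cite: CamachoLinsNeto1985, Ch. VII §2] -/
theorem exists_vanishingCycle_of_essential_leaf [LocallyConnectedSpace B] {y₀ : P.gr.X₀} (hK : IsCompact ((P.contourFol ho).leaf y₀))
    (hess : ¬ ImageNull (P.starData ho).foliated y₀)
    (hGEN : ∀ v ∈ P.punct, ∀ w ∈ P.punct, v ∈ discLeaf (P.contourFol ho) P.gr.planeEmb y₀ → w ∈ discLeaf (P.contourFol ho) P.gr.planeEmb y₀ →
      P.IsVtx v → P.IsVtx w → F.leaf (P.fillC v) = F.leaf (P.fillC w) → v = w) :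
    ∃ C : F.VanishingCycle, ∀ θ, C.fam 0 θ ∈ range P.fillC := by
  haveI : Nonempty P.gr.X₀ := ⟨y₀⟩
  have hbi : IsBiOriented (P.contourFol ho) := P.isBiOriented_contourFol ho
  have hι : IsOpenEmbedding P.gr.planeEmb := SquareGrid.Grid.isOpenEmbedding_planeEmb P.gr
  have ho' : (P.contourFol ho).IsTransverselyOriented := P.isTransverselyOriented_contourFol ho
  set D := P.starData ho with hD
  have hC : IsCompact (discLeaf (P.contourFol ho) P.gr.planeEmb y₀) := isCompact_discLeaf hbi hι hK
  have hgen := D.hgen_of_leaf_injOn (hbi := hbi) hC (fun v hv w hw hvC hwC hnv hnw hleaf ↦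
    hGEN v hv w hw hvC hwC (P.isVtx_of_fst_ne_zero ho hnv) (P.isVtx_of_fst_ne_zero ho hnw) hleaf)
  exact D.exists_vanishingCycle_of_essential_compact_leaf hbi hι ho' hgen hK (P.discLeaf_subset_Ω ho hK) hess

end Foliation.ConePosition

end Literature.Topology.FourManifolds
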